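import Summits.HodgeConjecture.HodgeConjecture.Theorems.F0P3HolFormClosedSubrep     -- ★ B3-CM (F0P3-p02 (g3)): the `W`-package of a holomorphic cotangent form (its construction is re-run here)
import Summits.HodgeConjecture.HodgeConjecture.Theorems.F0P3HolFormGenClasses       -- ★ B4b: `lieSpan_eq_span_iterLieDeriv`, `coe_mem_l2OfForms_of_mem_gen`
import Literature.NumberTheory.Automorphic.U21AnalyticVectors                        -- ★ Nelson–Harish-Chandra `analyticAt_inner_rightRegular_toLp_of_u21_null_of_mem_lieSpan`
import HarnessLib

/-!
# Crux `H413` — F1b road, brick (H3-ana): the matrix coefficients of the `U(2,1)`-orbits of the classes of the `𝔤`-span of a holomorphic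
# cotangent form are REAL ANALYTIC along every one-parameter subgroup (Nelson–Harish-Chandra at the CM pin)

Floor-0 programme P3 «U3-mult», seat F0P3-p03 (g4); crux item stmt-HodgeConjecture-24833 (`HCCMUnconditional.H413`); rung-1 line
`Cruxes/H413/Lines/F0_U3LettersRung1.lean` ed. 2.5, letter `stub_F1b_cm`; F0P3-plan (g2) ruling 2026-08-31T03:23:27Z, step (H3) `C_Φ ≅ C_{Φ′}`: both
proofs (H3-R ★ `F0P3ArchRepIsometricExtension.areUnitarilyEquivalent_closure_of_isometricIntertwiner`, hypothesis `hana`; H3-GNS identity principle)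
need the one-parameter WEAK ANALYTICITY of the orbits of the generated module `gen(Φ)`.  PROOF lane, no definition, no sorry;
`--supports stmt-HodgeConjecture-24833`.  HC_CM is proved only modulo the printed citations until rung 0 closes.

THE STATEMENT.  CM frame `(L, ι, H, T, hT)`, `H` definite away from `ι`, `[L⁺ : ℚ] ≥ 2` (compact quotient), `Φ ∈ holCotForms`, `S(Φ)` the `𝔤`-span of
its coordinates (`span {iterLieDeriv cmArchSection l Φⱼ}`).  For every class `y ∈ l2OfForms 𝒰 μ S(Φ)`, every `u ∈ L²`, every `X′ ∈ 𝔲(2,1)`: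
`t ↦ ⟪u, R(cmArchSection (exp tX′)) y⟫` is real analytic on `ℝ` (§1 `analyticAt_inner_rightRegular_cmArchSection_expMem`) — Nelson–Harish-Chandra ★
`U21AnalyticVectors.analyticAt_inner_rightRegular_toLp_of_u21_null_of_mem_lieSpan` fed with the `W`-package of ★ B3-CM `F0P3HolFormClosedSubrep`
(smooth, left-invariant, `K_c`∕`K_f`-invariant functions; `V = span {Φ₀, Φ₁}` finite-dimensional, `𝔨`-stable by the cotangent weight, `𝔭⁻`-null by the
Cauchy–Riemann germ), whose construction is repeated verbatim (it is not exported by B3-CM).  §2 reads it in the CM frame `uFormGroup (Fin 2) (Fin 1)` of ★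
D4-CM: for `x ∈ gen (P.archRepLieCM ι T hT) i (span {v₀, v₁})` (coordinate classes `vⱼ`, ★ B4b `coe_mem_l2OfForms_of_mem_gen`), `u ∈ P`, `X ∈ 𝔲(2,1)_{Fin 2 ⊕ Fin 1}`:
`t ↦ ⟪u, P.archRepCM ι T hT (exp tX) x⟫` is real analytic (`analyticAt_inner_archRepCM_expMem_of_mem_gen`; frames matched by ★ `cmArchSectionUForm_expMem_smul`).
[cite: Nelson1959, §8] [cite: HarishChandraTAMS1953, Lemma 34; Cor. to Thm 2] [cite: BorelWallach2000, VII 3.2]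
-/

-- Mathlib idiom (as in ★ `GKModules` and the T6∕B-road files): commutator bracket on `Module.End`, needed to MENTION `P.archRepLieCM`
attribute [local instance 100] LieRing.ofAssociativeRing

set_option autoImplicit false
-- the mandated namespace repeats `HodgeConjecture.HodgeConjecture`, as in every `Theorems/*.lean` of this sub-problem
set_option linter.dupNamespace false

noncomputable section

open scoped Matrix MatrixGroups Topology InnerProductSpace ENNReal ComplexConjugate ComplexOrder
open MeasureTheory NumberField Filter MulAction
open Literature.NumberTheory.Automorphic Literature.NumberTheory.Automorphic.UnitaryGroup
open Literature.NumberTheory.Automorphic.UnitaryGroup.CotangentForms (toQuotFun toQuotFun_mk cmArchSection cmCompactFactor holCotForms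
  mem_holCotForms_iff)
open Literature.Geometry.ComplexHyperbolic Literature.Geometry.ComplexHyperbolic.BallModel
open Literature.AlgebraicGeometry.ShimuraVarieties Literature.AlgebraicGeometry.ShimuraVarieties.BallForms
open Summit.HodgeConjecture.HodgeConjecture.Cruxes.H413.SpectrumJunction
open Summit.HodgeConjecture.HodgeConjecture.Cruxes.H413.F0P2aArchOrthPrelim
open Summit.HodgeConjecture.HodgeConjecture.Cruxes.H413.F0P2aCmFrameFactorisation
open Summit.HodgeConjecture.HodgeConjecture.Cruxes.H413.F0P2aArchOrthHol (lieDeriv_apply_mul_left lieDeriv_apply_mul_right lieSpan_le le_lieSpan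
  lieDeriv_lincomb iterLieDeriv_mem_of_stable)
open Summit.HodgeConjecture.HodgeConjecture.Cruxes.H413.F0P2aL2bHolArchSmooth (isArchSmooth_apply_of_mem_holCotForms_cm)
open Summit.HodgeConjecture.HodgeConjecture.Cruxes.H413.F0P2aL2bSliceContinuous (continuous_of_continuous_cmSlice)
open Summit.HodgeConjecture.HodgeConjecture.Cruxes.H413.F0P3LieSpanClosureInvariant
open Literature.RepresentationTheory.KonnoKonno2007 Literature.RepresentationTheory.KonnoKonno2007.RealDualPair
open Summit.HodgeConjecture.HodgeConjecture.Cruxes.H413.F0P3HolFormClosedSubrep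
open Summit.HodgeConjecture.HodgeConjecture.Cruxes.H413.F0P3HolFormGenClasses (lieSpan_eq_span_iterLieDeriv coe_mem_l2OfForms_of_mem_gen)
open Summit.HodgeConjecture.HodgeConjecture.Cruxes.H413.F0P3CMFrameOrbit (cmArchSectionUForm_expMem_smul)
open Summit.HodgeConjecture.HodgeConjecture.Cruxes.H413.F0P2aL2cOrderedProducts (reindex_mem_u21Lie)
open Summit.HodgeConjecture.HodgeConjecture.Cruxes.H413.F0P3CotangentFormL2Span (memLp_toQuotFun_apply)
open Summit.HodgeConjecture.HodgeConjecture.Cruxes.H413.F0P3bPNullGeneration (gen)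

namespace Summit.HodgeConjecture.HodgeConjecture.Cruxes.H413.F0P3GenOrbitAnalytic

variable (L : Type) [Field L] [NumberField L] [IsCMField L] (ι : L →+* ℂ) (H : Matrix (Fin 3) (Fin 3) L) (T : GL (Fin 3) ℂ)
  (hT : (T : Matrix (Fin 3) (Fin 3) ℂ)ᴴ * H.map ι * (T : Matrix (Fin 3) (Fin 3) ℂ) = Literature.Geometry.ComplexHyperbolic.BallModel.J)

/-! ## §1 Ball-model frame: analyticity of the coefficients of `R(cmArchSection (exp tX′))` on the classes of `S(Φ)` -/

/-- **Nelson–Harish-Chandra at the CM pin**: for `Φ ∈ holCotForms` (compact quotient) and a class `y` of the `𝔤`-span `S(Φ)`, every matrix coefficient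
`t ↦ ⟪u, R(cmArchSection (exp tX′)) y⟫` is real analytic on `ℝ` (★ `analyticAt_inner_rightRegular_toLp_of_u21_null_of_mem_lieSpan` with the
`W`-package of ★ B3-CM re-run). [cite: Nelson1959, §8] [cite: HarishChandraTAMS1953, Lemma 34] [cite: BorelWallach2000, VII 3.2] -/
theorem analyticAt_inner_rightRegular_cmArchSection_expMem
    (hdef : ∀ τ' : L →+* ℂ, InfinitePlace.mk τ' ≠ InfinitePlace.mk ι → (H.map τ').PosDef) (h2 : 2 ≤ Module.finrank ℚ ↥(maximalRealSubfield L))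
    (μ : Measure (adelicGroupData (↥(maximalRealSubfield L)) L (IsCMField.complexConj L) 3 H).automorphicQuotient)
    [(adelicGroupData (↥(maximalRealSubfield L)) L (IsCMField.complexConj L) 3 H).IsAutomorphicMeasure μ]
    {Φ : (adelicGroupData (↥(maximalRealSubfield L)) L (IsCMField.complexConj L) 3 H).Adelic → (Fin 2 → ℂ)}
    (hΦ : Φ ∈ holCotForms (↥(maximalRealSubfield L)) L (IsCMField.complexConj L) 3 H (cmArchSection L ι H T hT) (cmCompactFactor L ι H T hT))
    {y : (adelicGroupData (↥(maximalRealSubfield L)) L (IsCMField.complexConj L) 3 H).L2 μ}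
    (hy : y ∈ l2OfForms (adelicGroupData (↥(maximalRealSubfield L)) L (IsCMField.complexConj L) 3 H) μ (Submodule.span ℂ (Set.range fun p : List u21Group.lie × Fin 2 =>
      iterLieDeriv (H := u21Group) (cmArchSection L ι H T hT) p.1 fun x => Φ x p.2)))
    (X' : u21Group.lie) (u : (adelicGroupData (↥(maximalRealSubfield L)) L (IsCMField.complexConj L) 3 H).L2 μ) (t₀ : ℝ) :
    AnalyticAt ℝ (fun t : ℝ => ⟪u, (adelicGroupData (↥(maximalRealSubfield L)) L (IsCMField.complexConj L) 3 H).rightRegular μ (cmArchSection L ι H T hT (u21Group.expMem (t • X'))) y⟫_ℂ) t₀ := by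
  have hm : ∀ j : Fin 2, MemLp (toQuotFun (adelicGroupData (↥(maximalRealSubfield L)) L (IsCMField.complexConj L) 3 H) fun x => Φ x j) 2 μ := by
    haveI := F0P3HolProjectionReduction.compactSpace_automorphicQuotient_cm hdef h2 (L := L) (ι := ι) (H := H)
    exact fun j => memLp_toQuotFun_apply ι T hT (μ := μ) hΦ j
  -- the archimedean section and the compact quotient
  let ιA : ↥U21 →* (adelicGroupData (↥(maximalRealSubfield L)) L (IsCMField.complexConj L) 3 H).Adelic := cmArchSection L ι H T hT
  have hιA : Continuous ιA := continuous_archSectionU21CM L ι H T hT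
  have h4 : 4 ≤ Module.finrank ℚ L := by
    have h := Module.finrank_mul_finrank ℚ ↥(maximalRealSubfield L) L
    rw [Algebra.IsQuadraticExtension.finrank_eq_two ↥(maximalRealSubfield L) L] at h
    omega
  obtain ⟨τ, hτ⟩ := exists_infinitePlace_ne L h4 ι
  haveI : CompactSpace (adelicGroupData (↥(maximalRealSubfield L)) L (IsCMField.complexConj L) 3 H).automorphicQuotient :=
    compactSpace_cmDatum_automorphicQuotient_of_posDef L 3 H τ (hdef τ hτ)
  -- commutation of `ι_∞(U(2,1))` with `K_c` and with `U(H)(𝔸_f)`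
  have hcommK : ∀ k ∈ cmCompactFactor L ι H T hT, ∀ u' : ↥U21, ιA u' * k = k * ιA u' := fun k hk u' =>
    cmArchSection_mul_of_mem_cmCompactFactor L ι H T hT u' hk
  have hcommF : ∀ (g : finAdelic (↥(maximalRealSubfield L)) L (IsCMField.complexConj L) 3 H) (u' : ↥U21),
      ιA u' * finAdelicToAdelic (↥(maximalRealSubfield L)) L (IsCMField.complexConj L) 3 H g =
        finAdelicToAdelic (↥(maximalRealSubfield L)) L (IsCMField.complexConj L) 3 H g * ιA u' := fun g u' =>
    cmArchSection_mul_finAdelicToAdelic L ι H T hT u' g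
  -- the space `W` of smooth, left-invariant, `K_c`- and `K_f`-invariant functions (★ `archOrthHol_of_cuts`, verbatim)
  let W : Submodule ℂ ((adelicGroupData (↥(maximalRealSubfield L)) L (IsCMField.complexConj L) 3 H).Adelic → ℂ) :=
    { carrier := {ψ | IsArchSmooth (H := u21Group) ιA ψ ∧
        (∀ γ ∈ (adelicGroupData (↥(maximalRealSubfield L)) L (IsCMField.complexConj L) 3 H).quotientSubgroup, ∀ g, ψ (γ * g) = ψ g) ∧
        (∀ k ∈ cmCompactFactor L ι H T hT, ∀ x, ψ (x * k) = ψ x) ∧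
        ∃ Kf : Subgroup (finAdelic (↥(maximalRealSubfield L)) L (IsCMField.complexConj L) 3 H),
          IsOpen (Kf : Set (finAdelic (↥(maximalRealSubfield L)) L (IsCMField.complexConj L) 3 H)) ∧
          ∀ k ∈ Kf, ∀ x, ψ (x * finAdelicToAdelic (↥(maximalRealSubfield L)) L (IsCMField.complexConj L) 3 H k) = ψ x}
      add_mem' := by
        rintro ψ ψ' ⟨h1, h2, h3, Kf, hKf, h4⟩ ⟨h1', h2', h3', Kf', hKf', h4'⟩
        refine ⟨IsArchSmooth.add (H := u21Group) ιA h1 h1', fun γ hγ g => ?_, fun k hk x => ?_, Kf ⊓ Kf', ?_, fun k hk x => ?_⟩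
        · simp only [Pi.add_apply, h2 γ hγ g, h2' γ hγ g]
        · simp only [Pi.add_apply, h3 k hk x, h3' k hk x]
        · rw [Subgroup.coe_inf]; exact hKf.inter hKf'
        · simp only [Pi.add_apply, h4 k hk.1 x, h4' k hk.2 x]
      zero_mem' := ⟨(archSmooth (H := u21Group) ιA).zero_mem, fun _ _ _ => rfl, fun _ _ _ => rfl, ⊤, isOpen_univ, fun _ _ _ => rfl⟩
      smul_mem' := by
        rintro a ψ ⟨h1, h2, h3, Kf, hKf, h4⟩
        refine ⟨IsArchSmooth.smul (H := u21Group) ιA a h1, fun γ hγ g => ?_, fun k hk x => ?_, Kf, hKf, fun k hk x => ?_⟩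
        · simp only [Pi.smul_apply, h2 γ hγ g]
        · simp only [Pi.smul_apply, h3 k hk x]
        · simp only [Pi.smul_apply, h4 k hk x] }
  have hWmem : ∀ {ψ}, ψ ∈ W ↔ IsArchSmooth (H := u21Group) ιA ψ ∧
        (∀ γ ∈ (adelicGroupData (↥(maximalRealSubfield L)) L (IsCMField.complexConj L) 3 H).quotientSubgroup, ∀ g, ψ (γ * g) = ψ g) ∧
        (∀ k ∈ cmCompactFactor L ι H T hT, ∀ x, ψ (x * k) = ψ x) ∧
        ∃ Kf : Subgroup (finAdelic (↥(maximalRealSubfield L)) L (IsCMField.complexConj L) 3 H),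
          IsOpen (Kf : Set (finAdelic (↥(maximalRealSubfield L)) L (IsCMField.complexConj L) 3 H)) ∧
          ∀ k ∈ Kf, ∀ x, ψ (x * finAdelicToAdelic (↥(maximalRealSubfield L)) L (IsCMField.complexConj L) 3 H k) = ψ x :=
    Iff.rfl
  have hsm : ∀ φ ∈ W, IsArchSmooth (H := u21Group) ιA φ := fun φ hφ => (hWmem.1 hφ).1
  have hleft : ∀ φ ∈ W, ∀ γ ∈ (adelicGroupData (↥(maximalRealSubfield L)) L (IsCMField.complexConj L) 3 H).quotientSubgroup,
      ∀ g, φ (γ * g) = φ g := fun φ hφ => (hWmem.1 hφ).2.1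
  have hlie : ∀ X : u21Group.lie, ∀ φ ∈ W, lieDeriv (H := u21Group) ιA X φ ∈ W := by
    intro X φ hφ
    obtain ⟨h1, h2, h3, Kf, hKf, h4⟩ := hWmem.1 hφ
    refine hWmem.2 ⟨isArchSmooth_lieDeriv_of_isArchSmooth (H := u21Group) ιA X h1, fun γ hγ g => ?_, fun k hk x => ?_, Kf, hKf,
      fun k hk x => ?_⟩
    · exact lieDeriv_apply_mul_left ιA X φ γ g (h2 γ hγ)
    · exact lieDeriv_apply_mul_right ιA X φ x k (fun u' => hcommK k hk u') (h3 k hk)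
    · exact lieDeriv_apply_mul_right ιA X φ x _ (fun u' => hcommF k u') (h4 k hk)
  have hcont : ∀ φ ∈ W, Continuous φ := fun φ hφ =>
    continuous_of_continuous_cmSlice L ι H T hT φ (continuous_slice_of_isArchSmooth ιA (hWmem.1 hφ).1) (hWmem.1 hφ).2.2.1 (hWmem.1 hφ).2.2.2
  have hinvQ : ∀ φ ∈ W, invQuot _ (toQuotFun (adelicGroupData (↥(maximalRealSubfield L)) L (IsCMField.complexConj L) 3 H) φ) = φ :=
    fun φ hφ => funext fun g => by rw [invQuot_apply, ← apply_eq_toQuotFun (hleft φ hφ) g]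
  have hmemLp : ∀ φ ∈ W, MemLp (toQuotFun (adelicGroupData (↥(maximalRealSubfield L)) L (IsCMField.complexConj L) 3 H) φ) 2 μ :=
    fun φ hφ => memLp_toQuotFun (hleft φ hφ) (hcont φ hφ) 2
  have hrep : W ≤ (adelicGroupData (↥(maximalRealSubfield L)) L (IsCMField.complexConj L) 3 H).l2Representable μ := fun φ hφ =>
    ⟨_, hmemLp φ hφ, hinvQ φ hφ⟩
  have hinj : ∀ (φ : (adelicGroupData (↥(maximalRealSubfield L)) L (IsCMField.complexConj L) 3 H).Adelic → ℂ) (hφ : φ ∈ W),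
      (adelicGroupData (↥(maximalRealSubfield L)) L (IsCMField.complexConj L) 3 H).l2ClassOf μ ⟨φ, hrep hφ⟩ = 0 → φ = 0 := by
    intro φ hφ h0
    rw [AdelicGroupData.l2ClassOf_eq (hmemLp φ hφ) (hinvQ φ hφ)] at h0
    by_contra hne
    exact toLp_toQuotFun_ne_zero (hleft φ hφ) (hcont φ hφ) (hmemLp φ hφ) hne h0
  -- the coordinates of `Φ` lie in `W`
  have hΦ' := mem_holCotForms_iff.1 hΦ
  have hΦW : ∀ i : Fin 2, (fun x => Φ x i) ∈ W := by
    intro i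
    obtain ⟨Kf, hKf, hfix⟩ := exists_isOpen_forall_apply_mul_eq_of_mem_smoothFun hΦ'.2.2.1
    refine hWmem.2 ⟨isArchSmooth_apply_of_mem_holCotForms_cm L ι H T hT hΦ i, fun γ hγ g => ?_, fun k hk x => ?_, Kf, hKf, fun k hk x => ?_⟩
    · simp only [leftInvariant_of_mem_holCotForms hΦ γ hγ g]
    · simp only [hΦ'.2.1 k hk x]
    · simp only [hfix k hk x]
  have hKΦ : ∀ (k : stabilizer (↥U21) x₀) (g : (adelicGroupData (↥(maximalRealSubfield L)) L (IsCMField.complexConj L) 3 H).Adelic),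
      Φ (g * ιA k) = (isPullbackCocycle_cotangentCocycle.weightOf x₀) k⁻¹ (Φ g) := fun k g => hΦ'.1.2 k g
  have hgerm : CotangentForms.IsHolGerm ιA Φ := hΦ'.2.2.2
  -- the span `V` of the coordinates: finite-dimensional, `𝔨`-stable, `𝔭⁻`-null
  set V : Submodule ℂ ((adelicGroupData (↥(maximalRealSubfield L)) L (IsCMField.complexConj L) 3 H).Adelic → ℂ) :=
    Submodule.span ℂ (Set.range fun j : Fin 2 => fun x => Φ x j) with hV_def
  have hVj : ∀ i : Fin 2, (fun x => Φ x i) ∈ V := fun i => Submodule.subset_span ⟨i, rfl⟩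
  have hVW : V ≤ W := Submodule.span_le.2 (by rintro _ ⟨i, rfl⟩; exact hΦW i)
  haveI hVfin : FiniteDimensional ℂ V := FiniteDimensional.span_of_finite ℂ (Set.finite_range _)
  -- elements of `V` are the combinations `a • Φ₀ + b • Φ₁`
  have hVmem : ∀ {φ}, φ ∈ V → ∃ a b : ℂ, φ = a • (fun x => Φ x 0) + b • (fun x => Φ x 1) := by
    intro φ hφ
    have hset : (Set.range fun j : Fin 2 => fun x => Φ x j) = {fun x => Φ x 0, fun x => Φ x 1} := by
      ext ψ
      simp only [Set.mem_range, Set.mem_insert_iff, Set.mem_singleton_iff]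
      constructor
      · rintro ⟨i, rfl⟩
        fin_cases i
        · exact Or.inl rfl
        · exact Or.inr rfl
      · rintro (rfl | rfl)
        · exact ⟨0, rfl⟩
        · exact ⟨1, rfl⟩
    rw [hV_def, hset] at hφ
    obtain ⟨a, b, rfl⟩ := Submodule.mem_span_pair.1 hφ
    exact ⟨a, b, rfl⟩
  have hsm0 : IsArchSmooth (H := u21Group) ιA (fun x => Φ x 0) := hsm _ (hΦW 0)
  have hsm1 : IsArchSmooth (H := u21Group) ιA (fun x => Φ x 1) := hsm _ (hΦW 1)
  have hlin : ∀ (X : u21Group.lie) (a b : ℂ), lieDeriv (H := u21Group) ιA X (a • (fun x => Φ x 0) + b • (fun x => Φ x 1)) =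
      a • lieDeriv (H := u21Group) ιA X (fun x => Φ x 0) + b • lieDeriv (H := u21Group) ιA X (fun x => Φ x 1) := fun X a b =>
    lieDeriv_lincomb ιA X hsm0 hsm1 a b
  have hVk : ∀ Y : u21Group.lie, (Y : Matrix (Fin 3) (Fin 3) ℂ) ∈ u21Group.compactLie →
      ∀ φ ∈ V, lieDeriv (H := u21Group) ιA Y φ ∈ V := by
    intro Y hY φ hφ
    have hYJ : (Y : Matrix (Fin 3) (Fin 3) ℂ) * J = J * (Y : Matrix (Fin 3) (Fin 3) ℂ) := (J_mul_eq_mul_J_of_mem_compactLie hY).symm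
    have hgen : ∀ i : Fin 2, lieDeriv (H := u21Group) ιA Y (fun x => Φ x i) ∈ V := by
      intro i
      have hfun : lieDeriv (H := u21Group) ιA Y (fun x => Φ x i) =
          -((Y : Matrix (Fin 3) (Fin 3) ℂ) 2 2) • (fun x => Φ x i) -
            ∑ i' : Fin 2, conj ((Y : Matrix (Fin 3) (Fin 3) ℂ) (Fin.castSucc i) (Fin.castSucc i')) • (fun x => Φ x i') := by
        funext x
        rw [lieDeriv_of_weight_eq ιA Φ hKΦ Y hYJ x i]
        simp only [Pi.sub_apply, Pi.smul_apply, Finset.sum_apply, smul_eq_mul]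
      rw [hfun]
      exact V.sub_mem (V.smul_mem _ (hVj i)) (V.sum_mem fun i' _ => V.smul_mem _ (hVj i'))
    obtain ⟨a, b, rfl⟩ := hVmem hφ
    rw [hlin]
    exact V.add_mem (V.smul_mem _ (hgen 0)) (V.smul_mem _ (hgen 1))
  have hVcr : ∀ φ ∈ V, ∀ b : Fin 2 → ℂ, lieDeriv (H := u21Group) ιA (liePMat (Complex.I • b)) φ =
      Complex.I • lieDeriv (H := u21Group) ιA (liePMat b) φ := by
    intro φ hφ b
    obtain ⟨a, a', rfl⟩ := hVmem hφ
    rw [hlin, hlin, lieDeriv_liePMat_I_smul_of_isHolGerm hgerm b 0, lieDeriv_liePMat_I_smul_of_isHolGerm hgerm b 1,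
      smul_add, smul_comm a, smul_comm a']
  -- the class `y` of a member of the `𝔤`-span
  obtain ⟨f, hf, hfy, hfS⟩ := mem_l2OfForms_iff.1 hy
  rw [← lieSpan_eq_span_iterLieDeriv ι T hT hΦ] at hfS
  rw [← hfy]
  exact analyticAt_inner_rightRegular_toLp_of_u21_null_of_mem_lieSpan ιA hιA hsm hlie hrep hinj V hVW hVk Complex.I Complex.I_mul_I hVcr
    hfS hf rfl X' u t₀

/-! ## §2 CM frame `uFormGroup (Fin 2) (Fin 1)`: analyticity of the coefficients of `P.archRepCM (exp tX)` on `gen(Φ)` -/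

/-- **The orbits of `gen(Φ)` under `P.archRepCM` have real-analytic matrix coefficients along every one-parameter subgroup of
`U(2,1)_{Fin 2 ⊕ Fin 1}`** (§1 read through ★ `cmArchSectionUForm_expMem_smul` and ★ B4b `coe_mem_l2OfForms_of_mem_gen`) — the `hana` input of ★
`F0P3ArchRepIsometricExtension.areUnitarilyEquivalent_closure_of_isometricIntertwiner` at the CM pin. [cite: Nelson1959, §8]
[cite: HarishChandraTAMS1953, Lemma 34; Thm. 8] -/
theorem analyticAt_inner_archRepCM_expMem_of_mem_gen
    (hdef : ∀ τ' : L →+* ℂ, InfinitePlace.mk τ' ≠ InfinitePlace.mk ι → (H.map τ').PosDef) (h2 : 2 ≤ Module.finrank ℚ ↥(maximalRealSubfield L))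
    (μ : Measure (adelicGroupData (↥(maximalRealSubfield L)) L (IsCMField.complexConj L) 3 H).automorphicQuotient)
    [(adelicGroupData (↥(maximalRealSubfield L)) L (IsCMField.complexConj L) 3 H).IsAutomorphicMeasure μ]
    (P : DiscreteAutomorphicRep (adelicGroupData (↥(maximalRealSubfield L)) L (IsCMField.complexConj L) 3 H) μ)
    {Φ : (adelicGroupData (↥(maximalRealSubfield L)) L (IsCMField.complexConj L) 3 H).Adelic → (Fin 2 → ℂ)}
    (hΦ : Φ ∈ holCotForms (↥(maximalRealSubfield L)) L (IsCMField.complexConj L) 3 H (cmArchSection L ι H T hT) (cmCompactFactor L ι H T hT))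
    (v : Fin 2 → P.archModuleCM ι T hT)
    (hv : ∀ j : Fin 2, ∃ hmj : MemLp (toQuotFun (adelicGroupData (↥(maximalRealSubfield L)) L (IsCMField.complexConj L) 3 H) fun x => Φ x j) 2 μ,
      (((v j : P.archModuleCM ι T hT) : P.space.toSubmodule) : (adelicGroupData (↥(maximalRealSubfield L)) L (IsCMField.complexConj L) 3 H).L2 μ) = hmj.toLp _)
    {x : P.archModuleCM ι T hT} (hx : x ∈ gen (P.archRepLieCM ι T hT) Complex.I (Submodule.span ℂ (Set.range v)))
    (u : P.space.toSubmodule) (X : (uFormGroup (Fin 2) (Fin 1)).lie) (t₀ : ℝ) :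
    AnalyticAt ℝ (fun t : ℝ => ⟪u, P.archRepCM ι T hT ((uFormGroup (Fin 2) (Fin 1)).expMem (t • X)) (x : P.space.toSubmodule)⟫_ℂ) t₀ := by
  haveI := F0P3HolProjectionReduction.compactSpace_automorphicQuotient_cm hdef h2 (L := L) (ι := ι) (H := H)
  have hv' : ∀ j : Fin 2, (((v j : P.archModuleCM ι T hT) : P.space.toSubmodule) : (adelicGroupData (↥(maximalRealSubfield L)) L (IsCMField.complexConj L) 3 H).L2 μ) =
      (memLp_toQuotFun_apply ι T hT (μ := μ) hΦ j).toLp (toQuotFun (adelicGroupData (↥(maximalRealSubfield L)) L (IsCMField.complexConj L) 3 H) fun x => Φ x j) := by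
    intro j
    obtain ⟨hmj, h⟩ := hv j
    exact h
  have hy := coe_mem_l2OfForms_of_mem_gen ι T hT P hΦ v hv' hx
  -- the reindexed copy `X′ ∈ 𝔲(2,1)` of `X`
  let X' : u21Group.lie := ⟨Matrix.reindex (finSumFinEquiv : Fin 2 ⊕ Fin 1 ≃ Fin 3) finSumFinEquiv
    (X : Matrix (Fin 2 ⊕ Fin 1) (Fin 2 ⊕ Fin 1) ℂ), reindex_mem_u21Lie X.2⟩
  have hX' : (X' : Matrix (Fin 3) (Fin 3) ℂ) = Matrix.reindex (finSumFinEquiv : Fin 2 ⊕ Fin 1 ≃ Fin 3) finSumFinEquiv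
      (X : Matrix (Fin 2 ⊕ Fin 1) (Fin 2 ⊕ Fin 1) ℂ) := rfl
  have h := analyticAt_inner_rightRegular_cmArchSection_expMem L ι H T hT hdef h2 μ hΦ hy X'
    ((u : P.space.toSubmodule) : (adelicGroupData (↥(maximalRealSubfield L)) L (IsCMField.complexConj L) 3 H).L2 μ) t₀
  refine h.congr (Filter.Eventually.of_forall fun t => ?_)
  show _ = ⟪u, _⟫_ℂ
  rw [Submodule.coe_inner, DiscreteAutomorphicRep.coe_archRep_apply, cmArchSectionUForm_expMem_smul L ι H T hT X X' hX' t]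

end Summit.HodgeConjecture.HodgeConjecture.Cruxes.H413.F0P3GenOrbitAnalytic

end
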